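import Summits.AtomisticToContinuum.Crystallization.Theorems.FrustratedLawDichotomyAperiodicGapRecordJunctionFourSectorCollarQuot
import Summits.AtomisticToContinuum.Crystallization.Theorems.FrustratedLawDichotomyStrainedPatchHomXiWindow

/-!
# FrustratedLawDichotomy · crux `AperiodicFrustratedLawGap` (stmt-AtomisticToContinuum-27623) — THE H-SIDE IN THE ξ-WINDOW CURRENCY (lens-5 NODE 100 «XiWindow»,
# `…StrainedPatchHomXiWindow`, critic rows 1481 (D) ①, 1611 (B) (γ), 1619 (95)): the fcc HALF from the fcc Boolean of record, (H) from that Boolean and the three hcp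
# window pieces, and the crux consumers over them (decomp-a2c hand 2, generation 43; structural #38; DEF-FREE)

NODE 100 cuts `(H) HomFloor m` EXACTLY (`homFloor_iff_windowPieces`, any zone `Zone`, sheet `σ̂`, radius `r`) into the fcc half `HomFloorFcc ⊤ m` «T-architecture, unchanged» and
three hcp pieces — the tube ADMISSIBILITY LEMMA `XiTube Zone σ̂ r` [UNDECIDED · ANALYTIC-INSTRUMENT = Steele first-star force floor], the hcp floor on (zone ∧ tube)
[INSTRUMENTABLE, sheet-centred cells] and the hcp floor off the zone [(E∣U-far), energy piece].  The tree so far produces `HomFloorFcc` ONLY from a full `HomFloor`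
(`homFloorFcc_of_homFloor`); the fcc DATA of record is the Boolean `semOKF μ rootC rootW = true` (`…HomEntrySemanticFcc.fccHalf_of_semOKF`, pruned box sums over the polar
factor).  This file closes that seam and reads the crux through the window, most general first:

* §1 ★★ `homFloorFcc_top_of_prunedBoxSum` (per-`G` prune-or-floor ⟹ `HomFloorFcc ⊤ m`; the fcc branch of `…HomPruned.homFloor_of_prunedBoxSums` ALONE),
  `…_selfAdjoint` (polar reduction `prunedBoxSum_fcc_reduction`), ★★ `homFloorFcc_top_of_semOKF` (the Boolean at any level `μ` with `2 (m + e_W) SC ≤ μ`),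
  `homFloorFcc_top_of_entryTree6RBKP4` (the v4 `∃`-tree of record).
* §2 ★★★ `homFloor_of_semOKF_windowPieces` — `(H) HomFloor m` ⟸ fcc Boolean ∧ `XiTube Zone σ̂ r` ∧ `HomFloorHcp (Zone ∧ tube) m` ∧ `HomFloorHcp (¬Zone) m` (NODE 100's assembly
  `homFloor_of_windowPieces` with §1 as its fcc input); the `∃`-tree form; the record zone `BondCap (107/100)`, `r = 1/64` (XI-100 (γ)).
* §2b (appended, g43) CONTAINMENT: `homFloorHcp_of_prunedBoxSum` / `_selfAdjoint` / ★★ `homFloorHcp_of_semOKHQ` — the hcp quarter-root Boolean gives `HomFloorHcp Zh m`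
  for EVERY zone, so the quotient currency is the `Zone := ⊤` member of the window currency (no `XiTube` needed there).
* §3 ★★★ the 27623 consumers in this currency: `aperiodicFrustratedLawGap_of_semOKF_windowPieces_fourSector_collar_A35000_T26_record` (T-far = the COLLARED four-sector cut,
  #37 §1) and `…_of_semOKF_windowPieces_fourSector_A35000_T26_record` (T-far = the record four-sector cut, #35 §2); the BondCap/`1/64` record instance.

One-line compositions of landed theorems (§1's first lemma re-runs the fcc branch of `homFloor_of_prunedBoxSums`, 8 lines); 0 sorry; no definitions; standard axioms.
`--supports stmt-AtomisticToContinuum-27623`.  [folklore instantiation]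
-/

noncomputable section

open scoped BigOperators Classical RealInnerProductSpace
open Literature.Analysis.ValidatedNumerics.Numerics
open Literature.Barriers.AtomisticToContinuum.FlatleyTheil2015 (fccVec)
open Summit.AtomisticToContinuum.Crystallization.Theorems.ChargedEnergyGapNegative (eStar E3)
open Summit.AtomisticToContinuum.Crystallization.Theorems.FrustratedLawDichotomyRangeCut
open Summit.AtomisticToContinuum.Crystallization.Theorems.FrustratedLawDichotomySchurCut
open Summit.AtomisticToContinuum.Crystallization.Theorems.FrustratedLawDichotomyMotifLemmas (GoodAtScale)
open Summit.AtomisticToContinuum.Crystallization.Theorems.FrustratedLawDichotomyAveragingCut (ballAvg)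
open Summit.AtomisticToContinuum.Crystallization.Theorems.FrustratedLawDichotomyAveragingRuleTightFree (TightNearCap BadNearCap)
open Summit.AtomisticToContinuum.Crystallization.Theorems.FrustratedLawDichotomyExemptAbsorption (ExemptNear)
open Summit.AtomisticToContinuum.Crystallization.Theorems.FrustratedLawDichotomyExemptLocOpt (LocOptFails)
open Summit.AtomisticToContinuum.Crystallization.Theorems.FrustratedLawDichotomyExemptSplit (SchurElasticPricingX)
open Summit.AtomisticToContinuum.Crystallization.Theorems.FrustratedLawDichotomyExemptAbsorptionRecord
open Summit.AtomisticToContinuum.Crystallization.Theorems.FrustratedLawDichotomyCollarCensus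
open Summit.AtomisticToContinuum.Crystallization.Theorems.FrustratedLawDichotomyCollarCensusKappa
open Summit.AtomisticToContinuum.Crystallization.Theorems.FrustratedLawDichotomyStrainedPatchHomSplit
open Summit.AtomisticToContinuum.Crystallization.Theorems.FrustratedLawDichotomyStrainedPatchHomLattice (ballAvg_xRec_eq_latticeSum_fcc ballAvg_xRec_eq_latticeSum_hcp)
open Summit.AtomisticToContinuum.Crystallization.Theorems.FrustratedLawDichotomyStrainedPatchHomLatticeBox (latticeSum_fcc_eq_boxSum_record)
open Summit.AtomisticToContinuum.Crystallization.Theorems.FrustratedLawDichotomyStrainedPatchHomLatticeBoxHcp (latticeSum_hcp_eq_boxSum_record)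
open Summit.AtomisticToContinuum.Crystallization.Theorems.FrustratedLawDichotomyStrainedPatchHomIsometry (prunedBoxSum_fcc_reduction prunedBoxSum_hcp_reduction)
open Summit.AtomisticToContinuum.Crystallization.Theorems.FrustratedLawDichotomyStrainedPatchHomEntrySemanticQuot (semOKHQ rootCHQ rootWHQ hcpHalf_of_semOKHQ)
open Summit.AtomisticToContinuum.Crystallization.Theorems.FrustratedLawDichotomyStrainedPatchCleanCollar (CleanBall TailPenalty AnnularDefectFloor
  DefectiveCollarFloor tailOut)
open Summit.AtomisticToContinuum.Crystallization.Theorems.FrustratedLawDichotomyStrainedPatchPhaseCut (MonoPhaseBall AnnularPhaseFloor PolyTextureFloor)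
open Summit.AtomisticToContinuum.Crystallization.Theorems.FrustratedLawDichotomyStrainedPatchCoreTube (NearHomIsoAt CoreOffTubeFloor RimOffTubeFloor)
open Summit.AtomisticToContinuum.Crystallization.Theorems.FrustratedLawDichotomyStrainedPatchCoreTubeRecord (CoreCoreRelief)
open Summit.AtomisticToContinuum.Crystallization.Theorems.FrustratedLawDichotomyStrainedPatchChartFamilies (ChartBy FamilyLE familyLE_refl)
open Summit.AtomisticToContinuum.Crystallization.Theorems.FrustratedLawDichotomyStrainedPatchQuantSlaving
open Summit.AtomisticToContinuum.Crystallization.Theorems.FrustratedLawDichotomyStrainedPatchHostCells (TubeFloor)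
open Summit.AtomisticToContinuum.Crystallization.Theorems.FrustratedLawDichotomyStrainedPatchGradedTube
open Summit.AtomisticToContinuum.Crystallization.Theorems.FrustratedLawDichotomyStrainedPatchCoverBridge
open Summit.AtomisticToContinuum.Crystallization.Theorems.FrustratedLawDichotomyStrainedPatchPairTube
open Summit.AtomisticToContinuum.Crystallization.Theorems.FrustratedLawDichotomyStrainedPatchKernelCut
open Summit.AtomisticToContinuum.Crystallization.Theorems.FrustratedLawDichotomyStrainedPatchHomCertTree (CertTree treeOK)
open Summit.AtomisticToContinuum.Crystallization.Theorems.FrustratedLawDichotomyStrainedPatchHomEntryGram (rootC rootW)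
open Summit.AtomisticToContinuum.Crystallization.Theorems.FrustratedLawDichotomyStrainedPatchHomEntryLeafHT (entryLeafOK6RBKP4 semOKF fccHalf_of_semOKF
  semOKF_root_of_exists_tree4)
open Summit.AtomisticToContinuum.Crystallization.Theorems.FrustratedLawDichotomyAperiodicGapRecordJunctionHomFloorF6pT26 (level_ok_fallback_A35000_T26)
open Summit.AtomisticToContinuum.Crystallization.Theorems.FrustratedLawDichotomyStrainedPatchConeAnatomy
open Summit.AtomisticToContinuum.Crystallization.Theorems.FrustratedLawDichotomyStrainedPatchStiffSector
open Summit.AtomisticToContinuum.Crystallization.Theorems.FrustratedLawDichotomyStrainedPatchStiffDoor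
open Summit.AtomisticToContinuum.Crystallization.Theorems.FrustratedLawDichotomyStrainedPatchShearDoor
open Summit.AtomisticToContinuum.Crystallization.Theorems.FrustratedLawDichotomyStrainedPatchPairTubeCollar
open Summit.AtomisticToContinuum.Crystallization.Theorems.FrustratedLawDichotomyStrainedPatchHomXiWindow
open Summit.AtomisticToContinuum.Crystallization.Theorems.FrustratedLawDichotomyAperiodicGapRecordJunctionFourSectorQuot
  (aperiodicFrustratedLawGap_of_homFloor_fourSector_A35000_T26_record)
open Summit.AtomisticToContinuum.Crystallization.Theorems.FrustratedLawDichotomyAperiodicGapRecordJunctionFourSectorCollarQuot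
  (aperiodicFrustratedLawGap_of_homFloor_fourSector_collar_A35000_T26_record)

namespace Summit.AtomisticToContinuum.Crystallization.Theorems.FrustratedLawDichotomyAperiodicGapRecordJunctionXiWindowQuot

/-! ## §1. The fcc HALF of (H) in the window currency from the fcc data of record -/

/-- ★★ **`HomFloorFcc ⊤ m` FROM THE fcc PRUNED BOX SUMS ALONE**: for every frame `G` with `‖G − 1‖ ≤ 1/4`, EITHER every injective enumeration of the `G`-fcc ball has a
tight / exempt / bad centre ball (excluded by admissibility) OR the `[−7,7]³` box floor holds ⟹ the fcc half of the window cut.  (The fcc branch of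
`…HomPruned.homFloor_of_prunedBoxSums`, which needs the hcp hypothesis too; `ballAvg_xRec_eq_latticeSum_fcc`, `latticeSum_fcc_eq_boxSum_record`.) [folklore] -/
theorem homFloorFcc_top_of_prunedBoxSum {m : ℝ}
    (hfcc : ∀ G : E3 →L[ℝ] E3, ‖G - 1‖ ≤ 1 / 4 →
      (∀ (M : ℕ) (z : Fin M → E3) (c : Fin M), Function.Injective z →
          Set.range z = {x : E3 | dist x (z c) ≤ 133 / 10 ∧ ∃ a : Fin 3 → ℤ, x = z c + latPt G fccVec a} →
          TightNearCap (9 / 5) (3 / 2) z c ∨ ExemptNear (9 / 5) ExRec z c ∨ BadNearCap (9 / 5) (3 / 2) z c) ∨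
      m ≤ (∑ b ∈ (Fintype.piFinset fun _ : Fin 3 => Finset.Icc (-7 : ℤ) 7).filter (fun b => b ≠ 0),
        effPot w₄₅ ω₄ (3 / 400) ‖latPt G fccVec b‖) / 2 - (-(7175 / 10000) + 3 / 400)) :
    HomFloorFcc (fun _ => True) m := by
  rintro M z c hA ⟨G, hG, -, hrange⟩
  rcases hfcc G hG with hprune | hfloor
  · rcases hprune M z c hA.1 hrange with hT | hE | hB
    · exact absurd hT hA.2.2.2.1
    · exact absurd hE hA.2.2.2.2.1
    · exact absurd hB hA.2.2.2.2.2
  · rw [ballAvg_xRec_eq_latticeSum_fcc hA hrange, latticeSum_fcc_eq_boxSum_record hG]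
    exact hfloor

/-- ★ … from the SELF-ADJOINT (polar-factor) form — what the certificates state. [folklore: `prunedBoxSum_fcc_reduction`] -/
theorem homFloorFcc_top_of_prunedBoxSum_selfAdjoint {m : ℝ}
    (hfcc : ∀ U : E3 →L[ℝ] E3, (∀ v w : E3, inner ℝ (U v) w = inner ℝ v (U w)) → (∀ w : E3, 0 ≤ inner ℝ w (U w)) → ‖U - 1‖ ≤ 1 / 4 →
      (∀ (M : ℕ) (z : Fin M → E3) (c : Fin M), Function.Injective z →
          Set.range z = {x : E3 | dist x (z c) ≤ 133 / 10 ∧ ∃ a : Fin 3 → ℤ, x = z c + latPt U fccVec a} →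
          TightNearCap (9 / 5) (3 / 2) z c ∨ ExemptNear (9 / 5) ExRec z c ∨ BadNearCap (9 / 5) (3 / 2) z c) ∨
      m ≤ (∑ b ∈ (Fintype.piFinset fun _ : Fin 3 => Finset.Icc (-7 : ℤ) 7).filter (fun b => b ≠ 0),
        effPot w₄₅ ω₄ (3 / 400) ‖latPt U fccVec b‖) / 2 - (-(7175 / 10000) + 3 / 400)) :
    HomFloorFcc (fun _ => True) m :=
  homFloorFcc_top_of_prunedBoxSum (prunedBoxSum_fcc_reduction hfcc)

/-- ★★ **THE fcc HALF OF THE WINDOW CUT FROM THE fcc SEMANTIC ROOT FACT** `semOKF μ rootC rootW = true`, at any level `μ` with `2 (m + e_W) SC ≤ μ` — NODE 100's «fcc half,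
T-architecture unchanged», now by name. [folklore: §1 at `fccHalf_of_semOKF`] -/
theorem homFloorFcc_top_of_semOKF {m : ℝ} {μ : ℤ} (hμ : 2 * (m + (-(7175 / 10000) + 3 / 400)) * SC ≤ μ) (hF : semOKF μ rootC rootW = true) :
    HomFloorFcc (fun _ => True) m :=
  homFloorFcc_top_of_prunedBoxSum_selfAdjoint (fccHalf_of_semOKF hμ hF)

/-- ★ … from the v4 `∃`-tree of record over `entryLeafOK6RBKP4 μ`. [formal bookkeeping: `semOKF_root_of_exists_tree4`] -/
theorem homFloorFcc_top_of_entryTree6RBKP4 {m : ℝ} {μ : ℤ} (hμ : 2 * (m + (-(7175 / 10000) + 3 / 400)) * SC ≤ μ)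
    (hF : ∃ t : CertTree (Fin 3 × Fin 3), treeOK (entryLeafOK6RBKP4 μ) t rootC rootW = true) : HomFloorFcc (fun _ => True) m :=
  homFloorFcc_top_of_semOKF hμ (semOKF_root_of_exists_tree4 hF)

/-! ## §2. (H) from the fcc Boolean and the three hcp window pieces -/

/-- ★★★ **`(H) HomFloor m` FROM THE fcc BOOLEAN AND THE THREE hcp WINDOW PIECES** (any zone / sheet / radius): `semOKF μ rootC rootW = true` ∧ `XiTube Zone σ̂ r` ∧
`HomFloorHcp (Zone ∧ ‖ξ − σ̂ G‖ ≤ r) m` ∧ `HomFloorHcp (¬Zone) m` ⟹ `HomFloor m`. [folklore instantiation: `homFloor_of_windowPieces` at `homFloorFcc_top_of_semOKF`] -/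
theorem homFloor_of_semOKF_windowPieces {m : ℝ} {μ : ℤ} (hμ : 2 * (m + (-(7175 / 10000) + 3 / 400)) * SC ≤ μ) (hF : semOKF μ rootC rootW = true)
    (Zone : (E3 →L[ℝ] E3) → Prop) (σ : (E3 →L[ℝ] E3) → E3) (r : ℝ) (hT : XiTube (fun G _ => Zone G) σ r)
    (hE : HomFloorHcp (fun G ξ => Zone G ∧ ‖ξ - σ G‖ ≤ r) m) (hU : HomFloorHcp (fun G _ => ¬Zone G) m) : HomFloor m :=
  homFloor_of_windowPieces Zone σ r (homFloorFcc_top_of_semOKF hμ hF) hT hE hU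

/-- ★ … with the fcc side as the v4 `∃`-tree of record. [formal bookkeeping] -/
theorem homFloor_of_entryTree6RBKP4_windowPieces {m : ℝ} {μ : ℤ} (hμ : 2 * (m + (-(7175 / 10000) + 3 / 400)) * SC ≤ μ)
    (hF : ∃ t : CertTree (Fin 3 × Fin 3), treeOK (entryLeafOK6RBKP4 μ) t rootC rootW = true)
    (Zone : (E3 →L[ℝ] E3) → Prop) (σ : (E3 →L[ℝ] E3) → E3) (r : ℝ) (hT : XiTube (fun G _ => Zone G) σ r)
    (hE : HomFloorHcp (fun G ξ => Zone G ∧ ‖ξ - σ G‖ ≤ r) m) (hU : HomFloorHcp (fun G _ => ¬Zone G) m) : HomFloor m :=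
  homFloor_of_semOKF_windowPieces hμ (semOKF_root_of_exists_tree4 hF) Zone σ r hT hE hU

/-- ★ RECORD ZONE (XI-100 (γ)): bond cap `107/100`, cellwise sheet `σ̂`, tube radius `1/64`, fcc Boolean. [folklore instantiation] -/
theorem homFloor_of_semOKF_bondCapPieces {m : ℝ} {μ : ℤ} (hμ : 2 * (m + (-(7175 / 10000) + 3 / 400)) * SC ≤ μ) (hF : semOKF μ rootC rootW = true)
    (σ : (E3 →L[ℝ] E3) → E3) (hT : XiTube (fun G _ => BondCap (107 / 100) G) σ (1 / 64))
    (hE : HomFloorHcp (fun G ξ => BondCap (107 / 100) G ∧ ‖ξ - σ G‖ ≤ 1 / 64) m) (hU : HomFloorHcp (fun G _ => ¬BondCap (107 / 100) G) m) : HomFloor m :=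
  homFloor_of_semOKF_windowPieces hμ hF (fun G => BondCap (107 / 100) G) σ (1 / 64) hT hE hU

/-! ## §2b. Containment: the hcp QUOTIENT Boolean of record gives EVERY hcp window piece (appended, hand-2 g43) -/

/-- ★ **`HomFloorHcp Zh m` (ANY zone) FROM THE hcp PRUNED BOX SUMS ALONE**: for every `(G, ξ)` with `‖G − 1‖ ≤ 1/4`, `‖ξ‖ ≤ 1/4`, EITHER every injective enumeration of the
`(G, ξ)`-hcp ball is not separated / has a tight / exempt / bad centre ball OR the box floor holds ⟹ the hcp floor on every zone.  (The hcp branch of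
`…HomPruned.homFloor_of_prunedBoxSums` alone; `ballAvg_xRec_eq_latticeSum_hcp`, `latticeSum_hcp_eq_boxSum_record`.) [folklore] -/
theorem homFloorHcp_of_prunedBoxSum (Zh : (E3 →L[ℝ] E3) → E3 → Prop) {m : ℝ}
    (hhcp : ∀ (G : E3 →L[ℝ] E3) (ξ : E3), ‖G - 1‖ ≤ 1 / 4 → ‖ξ‖ ≤ 1 / 4 →
      (∀ (M : ℕ) (z : Fin M → E3) (c : Fin M), Function.Injective z →
          Set.range z = {x : E3 | dist x (z c) ≤ 133 / 10 ∧ ∃ a : Fin 3 → ℤ,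
            x = z c + latPt G hexFrame a ∨ x = z c + latPt G hexFrame a + G (hcpShift + ξ)} →
          ¬Sep z ∨ TightNearCap (9 / 5) (3 / 2) z c ∨ ExemptNear (9 / 5) ExRec z c ∨ BadNearCap (9 / 5) (3 / 2) z c) ∨
      m ≤ (∑ b ∈ (Fintype.piFinset fun _ : Fin 3 => Finset.Icc (-7 : ℤ) 7).filter (fun b => b ≠ 0),
          effPot w₄₅ ω₄ (3 / 400) ‖latPt G hexFrame b‖ +
        ∑ b ∈ (Fintype.piFinset fun _ : Fin 3 => Finset.Icc (-7 : ℤ) 7),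
          effPot w₄₅ ω₄ (3 / 400) ‖latPt G hexFrame b + G (hcpShift + ξ)‖) / 2 - (-(7175 / 10000) + 3 / 400)) :
    HomFloorHcp Zh m := by
  rintro M z c hA ⟨G, ξ, hG, hξ, -, hrange⟩
  rcases hhcp G ξ hG hξ with hprune | hfloor
  · rcases hprune M z c hA.1 hrange with hS | hT | hE | hB
    · exact absurd hA.2.1 hS
    · exact absurd hT hA.2.2.2.1
    · exact absurd hE hA.2.2.2.2.1
    · exact absurd hB hA.2.2.2.2.2
  · rw [ballAvg_xRec_eq_latticeSum_hcp hA hrange, latticeSum_hcp_eq_boxSum_record hG hξ]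
    exact hfloor

/-- ★ … from the SELF-ADJOINT (polar-factor) form, the shape `hcpHalf_of_semOKHQ` delivers. [folklore: `prunedBoxSum_hcp_reduction`, adapter `Or.inr`] -/
theorem homFloorHcp_of_prunedBoxSum_selfAdjoint (Zh : (E3 →L[ℝ] E3) → E3 → Prop) {m : ℝ}
    (hhcp : ∀ (U : E3 →L[ℝ] E3) (ξ : E3), (∀ v w : E3, inner ℝ (U v) w = inner ℝ v (U w)) → (∀ w : E3, 0 ≤ inner ℝ w (U w)) →
      ‖U - 1‖ ≤ 1 / 4 → ‖ξ‖ ≤ 1 / 4 →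
      (∀ (M : ℕ) (z : Fin M → E3) (c : Fin M), Function.Injective z →
          Set.range z = {x : E3 | dist x (z c) ≤ 133 / 10 ∧ ∃ a : Fin 3 → ℤ,
            x = z c + latPt U hexFrame a ∨ x = z c + latPt U hexFrame a + U (hcpShift + ξ)} →
          TightNearCap (9 / 5) (3 / 2) z c ∨ ExemptNear (9 / 5) ExRec z c ∨ BadNearCap (9 / 5) (3 / 2) z c) ∨
      m ≤ (∑ b ∈ (Fintype.piFinset fun _ : Fin 3 => Finset.Icc (-7 : ℤ) 7).filter (fun b => b ≠ 0),
          effPot w₄₅ ω₄ (3 / 400) ‖latPt U hexFrame b‖ +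
        ∑ b ∈ (Fintype.piFinset fun _ : Fin 3 => Finset.Icc (-7 : ℤ) 7),
          effPot w₄₅ ω₄ (3 / 400) ‖latPt U hexFrame b + U (hcpShift + ξ)‖) / 2 - (-(7175 / 10000) + 3 / 400)) :
    HomFloorHcp Zh m :=
  homFloorHcp_of_prunedBoxSum Zh fun G ξ hG hξ =>
    (prunedBoxSum_hcp_reduction hhcp G ξ hG hξ).imp (fun h M z c hz hr => Or.inr (h M z c hz hr)) id

/-- ★★ **CONTAINMENT**: the hcp QUARTER-root Boolean of record `semOKHQ μ rootCHQ rootWHQ = true` gives the hcp floor on EVERY zone — in particular both hcp window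
pieces of `homFloor_of_semOKF_windowPieces` (with `XiTube` not needed): the quotient currency (#37) is the `Zone := ⊤` member of the window currency.
[folklore: §2b at `hcpHalf_of_semOKHQ`] -/
theorem homFloorHcp_of_semOKHQ (Zh : (E3 →L[ℝ] E3) → E3 → Prop) {m : ℝ} {μ : ℤ} (hμ : 2 * (m + (-(7175 / 10000) + 3 / 400)) * SC ≤ μ)
    (hH : semOKHQ μ rootCHQ rootWHQ = true) : HomFloorHcp Zh m :=
  homFloorHcp_of_prunedBoxSum_selfAdjoint Zh (hcpHalf_of_semOKHQ hμ hH)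

/-! ## §3. ★★★ The 27623 consumers in the ξ-window currency -/

section Consumers

variable {𝓘₀ 𝓗 𝓘 𝓡 : ChartFam} {dA dB ℓc : ℝ} {βf₁ βf₂ βf₃ sf₁ sf₂ sf₃ : (M₀ : ℕ) → (Fin M₀ → E3) → Fin M₀ → ℝ}

/-- ★★★ **(F₆′) under (α) WITH THE H-SIDE IN THE ξ-WINDOW CURRENCY AND THE COLLARED FOUR-SECTOR T-FAR CELLS**: fcc Boolean `semOKF μ₇₄ rootC rootW = true` ∧ tube lemma
`XiTube Zone σ̂ r` ∧ hcp floor on (zone ∧ tube) ∧ hcp floor off the zone (both at `m = 3/5000 + 13/50000`) ∧ in-tube tail ∧ `CoreCoreRelief … (3/5000)` ∧ (E∣𝔇′)ᴸ ∧ (E∣𝔅lo) ∧ (E∣𝔅hi) ∧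
(E∣𝔄) ∧ `𝓘₀`-cover ∧ (N∣𝔇′) ∧ (N∣𝔅lo) ∧ (N∣𝔅hi) ∧ hulls ∧ cap ∧ floors ∧ CC∪T₀ ∧ DD∪T₀ ∧ `0 ≤ D_X` ∧ Eopt-raw ⟹ crux; zone / sheet / radius / `ℓc` / functionals generic.
[folklore instantiation: #37 `…_of_homFloor_fourSector_collar_…` at §2 `homFloor_of_semOKF_windowPieces`] -/
theorem aperiodicFrustratedLawGap_of_semOKF_windowPieces_fourSector_collar_A35000_T26_record {εE CE DE DX : ℝ}
    (hε0 : 0 < εE) (hε1 : εE ≤ 1 / 10000) (hDX : 0 ≤ DX)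
    (hE : SchurElasticPricingX (1 / 20) (1 / 8) w₄₅ ω₄ (3 / 400) (-(7175 / 10000)) (1 / 10000) CE DE DX (LocOptFails eStar εE (3 / 2) 1))
    (hFcc : semOKF (-399210329969189) rootC rootW = true)
    (Zone : (E3 →L[ℝ] E3) → Prop) (σ : (E3 →L[ℝ] E3) → E3) (r : ℝ) (hX : XiTube (fun G _ => Zone G) σ r)
    (hHE : HomFloorHcp (fun G ξ => Zone G ∧ ‖ξ - σ G‖ ≤ r) (3 / 5000 + 13 / 50000)) (hHU : HomFloorHcp (fun G _ => ¬Zone G) (3 / 5000 + 13 / 50000))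
    (hT : ∀ (M : ℕ) (z : Fin M → E3) (c : Fin M), Admissible M z c → CleanBall (63 / 10) z c → MonoPhaseBall (63 / 10) z c →
      NearHomIsoAt (26 / 5) (1 / 100) z c → -(13 / 50000) ≤ ballAvg (9 / 5) z (tailOut (26 / 5) M z c) c)
    (hR : CoreCoreRelief (63 / 10) (63 / 10) (26 / 5) (1 / 100) (3 / 5000))
    (hED : TubeFloorGBLenBy (famAnd (famAnd 𝓘 (Dense dA)) 𝓡) ℓc βf₁ sf₁)
    (hEBlo : TubeFloorGB (famAnd (famAndNot (famAnd 𝓘 (Dense dA)) 𝓡) (Dense dB)) (1 / 25) (constTol (1 / 25)) (relConeBy 2 βf₂ sf₂ (1 / 25)))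
    (hEBhi : TubeFloorGB (famAndNot (famAndNot (famAnd 𝓘 (Dense dA)) 𝓡) (Dense dB)) (1 / 25) (constTol (1 / 25)) (relConeBy 2 βf₃ sf₃ (1 / 25)))
    (hEA : TubeFloor (famAndNot 𝓘 (Dense dA)) (1 / 25))
    (hK : FamilyCoverGRecAt 𝓘₀ (26 / 5) (1 / 100))
    (hND : RefineGB (famAnd (famAnd 𝓘₀ (Dense dA)) 𝓡) 𝓗 (26 / 5) (1 / 100) (1 / 8) (1 / 25) (constTol (1 / 25)) (1 / 25) (constTol (1 / 25))
      (stepPair 𝓡 (relConeLenBy 2 ℓc βf₁ sf₁ (1 / 25)) (relConeBy 2 (stepByF (Dense dB) βf₂ βf₃) (stepByF (Dense dB) sf₂ sf₃) (1 / 25))))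
    (hNBlo : RefineGB (famAnd (famAndNot (famAnd 𝓘₀ (Dense dA)) 𝓡) (Dense dB)) 𝓗 (26 / 5) (1 / 100) (1 / 8) (1 / 25) (constTol (1 / 25)) (1 / 25)
      (constTol (1 / 25)) (stepPair 𝓡 (relConeLenBy 2 ℓc βf₁ sf₁ (1 / 25)) (relConeBy 2 (stepByF (Dense dB) βf₂ βf₃) (stepByF (Dense dB) sf₂ sf₃) (1 / 25))))
    (hNBhi : RefineGB (famAndNot (famAndNot (famAnd 𝓘₀ (Dense dA)) 𝓡) (Dense dB)) 𝓗 (26 / 5) (1 / 100) (1 / 8) (1 / 25) (constTol (1 / 25)) (1 / 25)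
      (constTol (1 / 25)) (stepPair 𝓡 (relConeLenBy 2 ℓc βf₁ sf₁ (1 / 25)) (relConeBy 2 (stepByF (Dense dB) βf₂ βf₃) (stepByF (Dense dB) sf₂ sf₃) (1 / 25))))
    (h𝓗 : FamilyLE (famAndNot 𝓘₀ (Dense dA)) 𝓗)
    (hcap : PairLE (stepPair 𝓡 (relConeLenBy 2 ℓc βf₁ sf₁ (1 / 25)) (relConeBy 2 (stepByF (Dense dB) βf₂ βf₃) (stepByF (Dense dB) sf₂ sf₃) (1 / 25)))
      (pairSum (constTol (1 / 25))))
    (h𝓘 : FamilyLE 𝓗 𝓘)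
    (hF : AnnularPhaseFloor (63 / 10) (24 / 5) (63 / 10) (1 / 1000)) (hP : PolyTextureFloor (63 / 10) (24 / 5) (1 / 1000))
    (hA : AnnularDefectFloor (24 / 5) (63 / 10)) (hD : DefectiveCollarFloor (24 / 5))
    (h2 : CrowdedCoreMotifPricingCapK (1 / 1000) (9 / 5) (133 / 10) (3 / 2) (effPot w₄₅ ω₄ (3 / 400)) (-(7175 / 10000) + 3 / 400)
      (Collar (9 / 2) fun N y j => (∃ s : ℝ, 0 ≤ s ∧ s ≤ 3 / 2 ∧ NonEquilibriumCore (-(7175 / 10000)) 0 7 s (1 / 10000) N y j) ∨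
        GoodAtScale (1 / 20) (3 / 2) y j))
    (h3 : DiluteDefectMotifPricingCapK (1 / 1000) (9 / 5) (133 / 10) (3 / 2) (effPot w₄₅ ω₄ (3 / 400)) (-(7175 / 10000) + 3 / 400)
      (Collar (9 / 2) fun N y j => (∃ s : ℝ, 0 ≤ s ∧ s ≤ 3 / 2 ∧ NonEquilibriumCore (-(7175 / 10000)) 0 7 s (1 / 10000) N y j) ∨
        GoodAtScale (1 / 20) (3 / 2) y j)) :
    Summit.AtomisticToContinuum.Crystallization.Theses.FrustratedLawDichotomy.AperiodicFrustratedLawGap :=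
  aperiodicFrustratedLawGap_of_homFloor_fourSector_collar_A35000_T26_record hε0 hε1 hDX hE
    (homFloor_of_semOKF_windowPieces level_ok_fallback_A35000_T26 hFcc Zone σ r hX hHE hHU) hT hR hED hEBlo hEBhi hEA hK hND hNBlo hNBhi h𝓗 hcap h𝓘 hF hP hA hD h2 h3

/-- ★★ **… WITH THE RECORD (un-collared) FOUR-SECTOR T-FAR CELLS** of #35 (`ℓc = 9/2`; dense table `relConeBy 2 (stepByF 𝓡 βf₁ (stepByF (Dense dB) βf₂ βf₃)) …`).
[folklore instantiation: #35 `…_of_homFloor_fourSector_…` at §2] -/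
theorem aperiodicFrustratedLawGap_of_semOKF_windowPieces_fourSector_A35000_T26_record {εE CE DE DX : ℝ}
    (hε0 : 0 < εE) (hε1 : εE ≤ 1 / 10000) (hDX : 0 ≤ DX)
    (hE : SchurElasticPricingX (1 / 20) (1 / 8) w₄₅ ω₄ (3 / 400) (-(7175 / 10000)) (1 / 10000) CE DE DX (LocOptFails eStar εE (3 / 2) 1))
    (hFcc : semOKF (-399210329969189) rootC rootW = true)
    (Zone : (E3 →L[ℝ] E3) → Prop) (σ : (E3 →L[ℝ] E3) → E3) (r : ℝ) (hX : XiTube (fun G _ => Zone G) σ r)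
    (hHE : HomFloorHcp (fun G ξ => Zone G ∧ ‖ξ - σ G‖ ≤ r) (3 / 5000 + 13 / 50000)) (hHU : HomFloorHcp (fun G _ => ¬Zone G) (3 / 5000 + 13 / 50000))
    (hT : ∀ (M : ℕ) (z : Fin M → E3) (c : Fin M), Admissible M z c → CleanBall (63 / 10) z c → MonoPhaseBall (63 / 10) z c →
      NearHomIsoAt (26 / 5) (1 / 100) z c → -(13 / 50000) ≤ ballAvg (9 / 5) z (tailOut (26 / 5) M z c) c)
    (hR : CoreCoreRelief (63 / 10) (63 / 10) (26 / 5) (1 / 100) (3 / 5000))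
    (hED : TubeFloorGB (famAnd (famAnd 𝓘 (Dense dA)) 𝓡) (1 / 25) (constTol (1 / 25)) (relConeBy 2 βf₁ sf₁ (1 / 25)))
    (hEBlo : TubeFloorGB (famAnd (famAndNot (famAnd 𝓘 (Dense dA)) 𝓡) (Dense dB)) (1 / 25) (constTol (1 / 25)) (relConeBy 2 βf₂ sf₂ (1 / 25)))
    (hEBhi : TubeFloorGB (famAndNot (famAndNot (famAnd 𝓘 (Dense dA)) 𝓡) (Dense dB)) (1 / 25) (constTol (1 / 25)) (relConeBy 2 βf₃ sf₃ (1 / 25)))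
    (hEA : TubeFloor (famAndNot 𝓘 (Dense dA)) (1 / 25))
    (hK : FamilyCoverGRecAt 𝓘₀ (26 / 5) (1 / 100))
    (hND : RefineGB (famAnd (famAnd 𝓘₀ (Dense dA)) 𝓡) 𝓗 (26 / 5) (1 / 100) (1 / 8) (1 / 25) (constTol (1 / 25)) (1 / 25) (constTol (1 / 25))
      (relConeBy 2 (stepByF 𝓡 βf₁ (stepByF (Dense dB) βf₂ βf₃)) (stepByF 𝓡 sf₁ (stepByF (Dense dB) sf₂ sf₃)) (1 / 25)))
    (hNBlo : RefineGB (famAnd (famAndNot (famAnd 𝓘₀ (Dense dA)) 𝓡) (Dense dB)) 𝓗 (26 / 5) (1 / 100) (1 / 8) (1 / 25) (constTol (1 / 25)) (1 / 25)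
      (constTol (1 / 25)) (relConeBy 2 (stepByF 𝓡 βf₁ (stepByF (Dense dB) βf₂ βf₃)) (stepByF 𝓡 sf₁ (stepByF (Dense dB) sf₂ sf₃)) (1 / 25)))
    (hNBhi : RefineGB (famAndNot (famAndNot (famAnd 𝓘₀ (Dense dA)) 𝓡) (Dense dB)) 𝓗 (26 / 5) (1 / 100) (1 / 8) (1 / 25) (constTol (1 / 25)) (1 / 25)
      (constTol (1 / 25)) (relConeBy 2 (stepByF 𝓡 βf₁ (stepByF (Dense dB) βf₂ βf₃)) (stepByF 𝓡 sf₁ (stepByF (Dense dB) sf₂ sf₃)) (1 / 25)))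
    (h𝓗 : FamilyLE (famAndNot 𝓘₀ (Dense dA)) 𝓗)
    (hcap : PairLE (relConeBy 2 (stepByF 𝓡 βf₁ (stepByF (Dense dB) βf₂ βf₃)) (stepByF 𝓡 sf₁ (stepByF (Dense dB) sf₂ sf₃)) (1 / 25))
      (pairSum (constTol (1 / 25))))
    (h𝓘 : FamilyLE 𝓗 𝓘)
    (hF : AnnularPhaseFloor (63 / 10) (24 / 5) (63 / 10) (1 / 1000)) (hP : PolyTextureFloor (63 / 10) (24 / 5) (1 / 1000))
    (hA : AnnularDefectFloor (24 / 5) (63 / 10)) (hD : DefectiveCollarFloor (24 / 5))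
    (h2 : CrowdedCoreMotifPricingCapK (1 / 1000) (9 / 5) (133 / 10) (3 / 2) (effPot w₄₅ ω₄ (3 / 400)) (-(7175 / 10000) + 3 / 400)
      (Collar (9 / 2) fun N y j => (∃ s : ℝ, 0 ≤ s ∧ s ≤ 3 / 2 ∧ NonEquilibriumCore (-(7175 / 10000)) 0 7 s (1 / 10000) N y j) ∨
        GoodAtScale (1 / 20) (3 / 2) y j))
    (h3 : DiluteDefectMotifPricingCapK (1 / 1000) (9 / 5) (133 / 10) (3 / 2) (effPot w₄₅ ω₄ (3 / 400)) (-(7175 / 10000) + 3 / 400)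
      (Collar (9 / 2) fun N y j => (∃ s : ℝ, 0 ≤ s ∧ s ≤ 3 / 2 ∧ NonEquilibriumCore (-(7175 / 10000)) 0 7 s (1 / 10000) N y j) ∨
        GoodAtScale (1 / 20) (3 / 2) y j)) :
    Summit.AtomisticToContinuum.Crystallization.Theses.FrustratedLawDichotomy.AperiodicFrustratedLawGap :=
  aperiodicFrustratedLawGap_of_homFloor_fourSector_A35000_T26_record hε0 hε1 hDX hE
    (homFloor_of_semOKF_windowPieces level_ok_fallback_A35000_T26 hFcc Zone σ r hX hHE hHU) hT hR hED hEBlo hEBhi hEA hK hND hNBlo hNBhi h𝓗 hcap h𝓘 hF hP hA hD h2 h3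

/-- ★★ **RECORD INSTANCE (XI-100 (γ))**: zone `BondCap (107/100)`, sheet `σ̂`, tube radius `1/64`, collared four-sector T-far cells — the objects of record on both sides by name.
[folklore instantiation] -/
theorem aperiodicFrustratedLawGap_of_semOKF_bondCapPieces_fourSector_collar_A35000_T26_record {εE CE DE DX : ℝ}
    (hε0 : 0 < εE) (hε1 : εE ≤ 1 / 10000) (hDX : 0 ≤ DX)
    (hE : SchurElasticPricingX (1 / 20) (1 / 8) w₄₅ ω₄ (3 / 400) (-(7175 / 10000)) (1 / 10000) CE DE DX (LocOptFails eStar εE (3 / 2) 1))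
    (hFcc : semOKF (-399210329969189) rootC rootW = true)
    (σ : (E3 →L[ℝ] E3) → E3) (hX : XiTube (fun G _ => BondCap (107 / 100) G) σ (1 / 64))
    (hHE : HomFloorHcp (fun G ξ => BondCap (107 / 100) G ∧ ‖ξ - σ G‖ ≤ 1 / 64) (3 / 5000 + 13 / 50000))
    (hHU : HomFloorHcp (fun G _ => ¬BondCap (107 / 100) G) (3 / 5000 + 13 / 50000))
    (hT : ∀ (M : ℕ) (z : Fin M → E3) (c : Fin M), Admissible M z c → CleanBall (63 / 10) z c → MonoPhaseBall (63 / 10) z c →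
      NearHomIsoAt (26 / 5) (1 / 100) z c → -(13 / 50000) ≤ ballAvg (9 / 5) z (tailOut (26 / 5) M z c) c)
    (hR : CoreCoreRelief (63 / 10) (63 / 10) (26 / 5) (1 / 100) (3 / 5000))
    (hED : TubeFloorGBLenBy (famAnd (famAnd 𝓘 (Dense dA)) 𝓡) ℓc βf₁ sf₁)
    (hEBlo : TubeFloorGB (famAnd (famAndNot (famAnd 𝓘 (Dense dA)) 𝓡) (Dense dB)) (1 / 25) (constTol (1 / 25)) (relConeBy 2 βf₂ sf₂ (1 / 25)))
    (hEBhi : TubeFloorGB (famAndNot (famAndNot (famAnd 𝓘 (Dense dA)) 𝓡) (Dense dB)) (1 / 25) (constTol (1 / 25)) (relConeBy 2 βf₃ sf₃ (1 / 25)))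
    (hEA : TubeFloor (famAndNot 𝓘 (Dense dA)) (1 / 25))
    (hK : FamilyCoverGRecAt 𝓘₀ (26 / 5) (1 / 100))
    (hND : RefineGB (famAnd (famAnd 𝓘₀ (Dense dA)) 𝓡) 𝓗 (26 / 5) (1 / 100) (1 / 8) (1 / 25) (constTol (1 / 25)) (1 / 25) (constTol (1 / 25))
      (stepPair 𝓡 (relConeLenBy 2 ℓc βf₁ sf₁ (1 / 25)) (relConeBy 2 (stepByF (Dense dB) βf₂ βf₃) (stepByF (Dense dB) sf₂ sf₃) (1 / 25))))
    (hNBlo : RefineGB (famAnd (famAndNot (famAnd 𝓘₀ (Dense dA)) 𝓡) (Dense dB)) 𝓗 (26 / 5) (1 / 100) (1 / 8) (1 / 25) (constTol (1 / 25)) (1 / 25)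
      (constTol (1 / 25)) (stepPair 𝓡 (relConeLenBy 2 ℓc βf₁ sf₁ (1 / 25)) (relConeBy 2 (stepByF (Dense dB) βf₂ βf₃) (stepByF (Dense dB) sf₂ sf₃) (1 / 25))))
    (hNBhi : RefineGB (famAndNot (famAndNot (famAnd 𝓘₀ (Dense dA)) 𝓡) (Dense dB)) 𝓗 (26 / 5) (1 / 100) (1 / 8) (1 / 25) (constTol (1 / 25)) (1 / 25)
      (constTol (1 / 25)) (stepPair 𝓡 (relConeLenBy 2 ℓc βf₁ sf₁ (1 / 25)) (relConeBy 2 (stepByF (Dense dB) βf₂ βf₃) (stepByF (Dense dB) sf₂ sf₃) (1 / 25))))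
    (h𝓗 : FamilyLE (famAndNot 𝓘₀ (Dense dA)) 𝓗)
    (hcap : PairLE (stepPair 𝓡 (relConeLenBy 2 ℓc βf₁ sf₁ (1 / 25)) (relConeBy 2 (stepByF (Dense dB) βf₂ βf₃) (stepByF (Dense dB) sf₂ sf₃) (1 / 25)))
      (pairSum (constTol (1 / 25))))
    (h𝓘 : FamilyLE 𝓗 𝓘)
    (hF : AnnularPhaseFloor (63 / 10) (24 / 5) (63 / 10) (1 / 1000)) (hP : PolyTextureFloor (63 / 10) (24 / 5) (1 / 1000))
    (hA : AnnularDefectFloor (24 / 5) (63 / 10)) (hD : DefectiveCollarFloor (24 / 5))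
    (h2 : CrowdedCoreMotifPricingCapK (1 / 1000) (9 / 5) (133 / 10) (3 / 2) (effPot w₄₅ ω₄ (3 / 400)) (-(7175 / 10000) + 3 / 400)
      (Collar (9 / 2) fun N y j => (∃ s : ℝ, 0 ≤ s ∧ s ≤ 3 / 2 ∧ NonEquilibriumCore (-(7175 / 10000)) 0 7 s (1 / 10000) N y j) ∨
        GoodAtScale (1 / 20) (3 / 2) y j))
    (h3 : DiluteDefectMotifPricingCapK (1 / 1000) (9 / 5) (133 / 10) (3 / 2) (effPot w₄₅ ω₄ (3 / 400)) (-(7175 / 10000) + 3 / 400)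
      (Collar (9 / 2) fun N y j => (∃ s : ℝ, 0 ≤ s ∧ s ≤ 3 / 2 ∧ NonEquilibriumCore (-(7175 / 10000)) 0 7 s (1 / 10000) N y j) ∨
        GoodAtScale (1 / 20) (3 / 2) y j)) :
    Summit.AtomisticToContinuum.Crystallization.Theses.FrustratedLawDichotomy.AperiodicFrustratedLawGap :=
  aperiodicFrustratedLawGap_of_semOKF_windowPieces_fourSector_collar_A35000_T26_record hε0 hε1 hDX hE hFcc (fun G => BondCap (107 / 100) G) σ (1 / 64)
    hX hHE hHU hT hR hED hEBlo hEBhi hEA hK hND hNBlo hNBhi h𝓗 hcap h𝓘 hF hP hA hD h2 h3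

end Consumers

end Summit.AtomisticToContinuum.Crystallization.Theorems.FrustratedLawDichotomyAperiodicGapRecordJunctionXiWindowQuot

end
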